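import Summits.BirchSwinnertonDyer.BirchSwinnertonDyer.Theorems.AdditiveKolyvaginRoadBottomTransferKrizLiLender
import Summits.BirchSwinnertonDyer.Rank1Residual.Additive.UnramifiedBaseChange
import Literature.NumberTheory.EllipticCurves.ModularityVersionApProofs
import HarnessLib

/-!
# Route `AdditiveKolyvaginRoad`, crux KS′ `LevelKolyvaginSystemsAdditive` (item stmt-BirchSwinnertonDyer-21396):
# Kriz–Li's depletion set on an avatar frame is `{p}` — the off-`p` unit condition `hdep` of the conductor-one transfer
# DISCHARGED from a frame-decidable sign condition (part 3 of the (γ) transfer; cell `pub/bsd-wall`, width seat `bsd-wall-akr-p2x-w3` g4;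
# `--supports stmt-BirchSwinnertonDyer-21396`, helper)

WHY. Parts 1–2 (`…BottomTransferKrizLiAtOne`, `…BottomTransferKrizLiLender`) prove the conductor-one bottom transfer of line
`epsilon_matched_retyping` (stub (A2), sub-row (γ)) from Kriz–Li Thm. 1.16, modulo the lender's lossless localisation and ONE
bookkeeping hypothesis `hdep`: every prime `ℓ ≠ p` of Kriz–Li's set `ℓ ∣ pNN₀/M` has `p ∤ |Ẽ₀^{ns}(𝔽_ℓ)|`. On an avatar frame
(`hrad`: `pN` and `pN₀` have the same prime factors; `htype`: the multiplicative primes of `E` and `E₀` coincide) a prime `ℓ ≠ p`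
enters that set only if `a_ℓ(E₀) ≢ a_ℓ(E) (mod p)`; at a common ADDITIVE prime both coefficients vanish, so only a multiplicative
prime with a SPLIT ∕ NON-SPLIT MISMATCH (`a_ℓ(E₀) = −a_ℓ(E) = ±1`) can enter — and `E[p] ≅ E₀[p]` does not exclude this when
`ℓ ≡ −1 (mod p)`. Hence:
* §1 `depletionPrimes_eq_singleton_of_sign` — under `hrad`, `htype` and the frame-decidable SIGN AGREEMENT
  `hsign : a_ℓ(E) = a_ℓ(E₀)` at every multiplicative `ℓ` of `E₀`, Kriz–Li's set is `{p}`; `hdep_of_sign` — so `hdep` holds vacuously.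
* §2 `exists_kolyvaginClass_ne_zero_of_thm116_of_sign` — the conductor-one transfer (GZ-free, parts 1 + 2) with `hdep` replaced by `hsign`:
  on the avatar locus of the line, Kriz–Li Thm. 1.16 (BY NAME) ∧ sign agreement ∧ «the lender's Heegner point is not `p`-divisible in
  `E₀(ℚ_p)` along `ιp`» ⟹ `∃ m d, d.kolyvaginClass _ 1 ≠ 0` (with `m = ∅`) — the conclusion of `stub_bottomTransfer`.

HONEST FRAMING: theorems only; 0 definitions, 0 named facts, 0 `sorry`; CONDITIONAL on `hKL` and on the lender's lossless localisation
(K-half, hypothesis). Closes nothing; KS′ is not proved; BSD is NOT proved by any of this.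

References: [cite: KrizLi2019, Thm. 1.16, Rem. 1.17] [cite: DiamondShurman2005, §8.3] [cite: SilvermanAEC2009, VII.11, App. C §15–16].
-/

set_option linter.dupNamespace false -- single-conjunct summit repeats the name by design

noncomputable section

open scoped Classical

namespace Summit.BirchSwinnertonDyer.BirchSwinnertonDyer.Theorems.AdditiveKoly

open WeierstrassCurve NumberField IsDedekindDomain Field
  Literature.NumberTheory.EllipticCurves Literature.NumberTheory.EllipticCurves.ModularForms
  Literature.NumberTheory.EllipticCurves.Rank1Residual Literature.NumberTheory.GaloisRepresentations
  Summit.BirchSwinnertonDyer.Rank1Residual Summit.BirchSwinnertonDyer.Rank1Residual.Additive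

/-! ## §1 The depletion set of an avatar pair -/

section Depletion

variable (W W₀ : WeierstrassCurve ℚ) [W.IsElliptic] [W.IsGloballyMinimal] [W₀.IsElliptic] [W₀.IsGloballyMinimal]
  (p : ℕ) [hp : Fact p.Prime]

omit [W.IsGloballyMinimal] [W₀.IsGloballyMinimal] in
/-- `a_ℓ = 0` at a prime of ADDITIVE reduction (`¬ good ∧ ¬ multiplicative`), prime-indexed. [cite: SilvermanAEC2009, App. C §16] -/
theorem lFunction_eq_zero_of_addv' {ℓ : ℕ} [Fact ℓ.Prime] (h : Addv W ℓ) : W.LFunction ℓ = 0 :=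
  W.LFunction_apply_eq_zero_of_hasAdditiveReductionAt (Additive.primesEquiv_symm_apply_coe ℓ)
    (Additive.hasAdditiveReductionAt_of_addv W ℓ h) dvd_rfl

omit [W.IsGloballyMinimal] [W₀.IsGloballyMinimal] in
/-- **Kriz–Li's set `ℓ ∣ pNN₀/M` of an avatar pair is `{p}`.** If `pN` and `pN₀` have the same prime factors (`hrad`), the
multiplicative primes of `E` and `E₀` coincide (`htype`), and `a_ℓ(E) = a_ℓ(E₀)` at every multiplicative prime of `E₀` (`hsign`, split ∕
non-split agreement), then every prime `ℓ ≠ p` dividing `pN₀N` divides both conductors with `a_ℓ(E₀) ≡ a_ℓ(E) (mod p)` (equal signs, or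
both `0` at a common additive prime), so it lies in `M`: `depletionPrimes p W₀ W = {p}`. [cite: KrizLi2019, Thm. 1.16 (the set `ℓ ∣ pNN′/M`)]
[cite: DiamondShurman2005, §8.3 (p ∣ N_E iff bad reduction)] -/
theorem depletionPrimes_eq_singleton_of_sign [NeZero (W.conductorNorm ℤ)] [NeZero (W₀.conductorNorm ℤ)]
    (hrad : ∀ q : ℕ, q.Prime → (q ∣ p * W.conductorNorm ℤ ↔ q ∣ p * W₀.conductorNorm ℤ))
    (htype : ∀ (ℓ : ℕ) [Fact ℓ.Prime], W.HasMultiplicativeReductionAtPrime ℓ ↔ W₀.HasMultiplicativeReductionAtPrime ℓ)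
    (hsign : ∀ (ℓ : ℕ) [Fact ℓ.Prime], W₀.HasMultiplicativeReductionAtPrime ℓ → W.LFunction ℓ = W₀.LFunction ℓ) :
    KrizLi2019.depletionPrimes p W₀ W = {p} := by
  ext ℓ
  constructor
  swap
  · intro h
    rw [Finset.mem_singleton] at h
    subst h
    exact KrizLi2019.self_mem_depletionPrimes ℓ W₀ W
  intro hℓ
  rw [Finset.mem_singleton]
  unfold KrizLi2019.depletionPrimes at hℓ
  rw [Finset.mem_filter, Nat.mem_primeFactors] at hℓ
  obtain ⟨⟨hℓprime, hℓdvd, -⟩, hcond⟩ := hℓ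
  by_contra hℓp
  rcases hcond with h | h
  · exact hℓp h
  apply h
  haveI : Fact ℓ.Prime := ⟨hℓprime⟩
  -- `ℓ ∣ N₀` and `ℓ ∣ N`
  have hℓN0N : ℓ ∣ W₀.conductorNorm ℤ * W.conductorNorm ℤ := by
    have h' : ℓ ∣ p * (W₀.conductorNorm ℤ * W.conductorNorm ℤ) := by rwa [← mul_assoc]
    exact ((Nat.Prime.dvd_mul hℓprime).mp h').resolve_left fun hd ↦
      hℓp ((Nat.prime_dvd_prime_iff_eq hℓprime hp.out).mp hd)
  have hnotp : ¬ ℓ ∣ p := fun hd ↦ hℓp ((Nat.prime_dvd_prime_iff_eq hℓprime hp.out).mp hd)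
  have hboth : ℓ ∣ W₀.conductorNorm ℤ ∧ ℓ ∣ W.conductorNorm ℤ := by
    rcases (Nat.Prime.dvd_mul hℓprime).mp hℓN0N with h0 | h1
    · refine ⟨h0, ?_⟩
      have := (hrad ℓ hℓprime).mpr (dvd_mul_of_dvd_right h0 p)
      exact ((Nat.Prime.dvd_mul hℓprime).mp this).resolve_left hnotp
    · refine ⟨?_, h1⟩
      have := (hrad ℓ hℓprime).mp (dvd_mul_of_dvd_right h1 p)
      exact ((Nat.Prime.dvd_mul hℓprime).mp this).resolve_left hnotp
  refine ⟨hboth.1, hboth.2, ?_⟩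
  by_cases hmult : W₀.HasMultiplicativeReductionAtPrime ℓ
  · rw [hsign ℓ hmult]
  · -- both curves are additive at `ℓ`: `a_ℓ = 0` on both sides
    have hbad₀ : ¬ W₀.HasGoodReductionAtPrime ℓ := (W₀.dvd_conductorNorm_iff_not_hasGoodReductionAtPrime ℓ).mp hboth.1
    have hbad : ¬ W.HasGoodReductionAtPrime ℓ := (W.dvd_conductorNorm_iff_not_hasGoodReductionAtPrime ℓ).mp hboth.2
    have hmult' : ¬ W.HasMultiplicativeReductionAtPrime ℓ := fun hm ↦ hmult ((htype ℓ).mp hm)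
    rw [lFunction_eq_zero_of_addv' W₀ ⟨hbad₀, hmult⟩, lFunction_eq_zero_of_addv' W ⟨hbad, hmult'⟩]

omit [W.IsGloballyMinimal] [W₀.IsGloballyMinimal] in
/-- **`hdep` of part 2 on an avatar frame with sign agreement**: with the depletion set equal to `{p}` there is no prime `ℓ ≠ p` in it.
[cite: KrizLi2019, Thm. 1.16] -/
theorem hdep_of_sign [NeZero (W.conductorNorm ℤ)] [NeZero (W₀.conductorNorm ℤ)]
    (hrad : ∀ q : ℕ, q.Prime → (q ∣ p * W.conductorNorm ℤ ↔ q ∣ p * W₀.conductorNorm ℤ))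
    (htype : ∀ (ℓ : ℕ) [Fact ℓ.Prime], W.HasMultiplicativeReductionAtPrime ℓ ↔ W₀.HasMultiplicativeReductionAtPrime ℓ)
    (hsign : ∀ (ℓ : ℕ) [Fact ℓ.Prime], W₀.HasMultiplicativeReductionAtPrime ℓ → W.LFunction ℓ = W₀.LFunction ℓ) :
    ∀ ℓ ∈ KrizLi2019.depletionPrimes p W₀ W, ℓ ≠ p → ¬ (p : ℤ) ∣ KrizLi2019.nsPointCount W₀ ℓ := by
  intro ℓ hℓ hℓp
  rw [depletionPrimes_eq_singleton_of_sign W W₀ p hrad htype hsign, Finset.mem_singleton] at hℓ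
  exact absurd hℓ hℓp

end Depletion

/-! ## §2 The conductor-one transfer on the avatar locus with sign agreement -/

section Transfer

variable (W : WeierstrassCurve ℚ) [W.IsElliptic] [W.IsGloballyMinimal] [NeZero (W.conductorNorm ℤ)]
  (p : ℕ) [hp : Fact p.Prime] (K : Type) [Field K] [NumberField K]
  (Dt : ModularParametrizationData W (W.conductorNorm ℤ)) (β : ℤ) (ι : K →+* ℂ)

/-- **THE CONDUCTOR-ONE BOTTOM TRANSFER ON THE AVATAR LOCUS** (sub-row (γ) of stub (A2) `stub_bottomTransfer`, line
`epsilon_matched_retyping`; parts 1–3). Frame: `E = W` globally minimal, ADDITIVE at `p ≥ 5`, `ρ̄_{E,p}` onto, `K` imaginary quadratic,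
`d_K < −4`, Heegner hypothesis for `N_E`, `4N_E ∣ β² − d_K`, `p ∤ c(Dt)`. Avatar `E₀ = W₀`: globally minimal, `Γ_ℚ`-equivariant
`E[p] ≃ E₀[p]`, GOOD NON-ANOMALOUS at `p`, `hrad`, `htype`, SIGN AGREEMENT `hsign` at the multiplicative primes, Heegner hypothesis for `N₀`,
`p` split, `p ∤ c(Dt₀)`. Input BY NAME: Kriz–Li Thm. 1.16. LENDER INPUT (K-half, hypothesis): some Heegner point `y₀ ∈ E₀(K)` over
`heegnerPointComplex Dt₀ H₀` is NOT `p`-divisible in `E₀(ℚ_p)` along `ιp`. CONCLUSION: `∃ m d, d.kolyvaginClass _ 1 ≠ 0` (`m = ∅`).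
[cite: KrizLi2019, Thm. 1.16, Rem. 1.17] [cite: GrossLMS1991, §4 (4.4)] [cite: McCallumLMS1991, Cor. 4.5] -/
theorem exists_kolyvaginClass_ne_zero_of_thm116_of_sign (hKL : KrizLi2019.thm116_padicLogHeegner_congruence)
    (hp5 : 5 ≤ p) (hadd : Addv W p) (hs : W.HasSurjectiveModNGaloisRep p)
    (hK : IsImaginaryQuadratic K) (hlt : NumberField.discr K < -4)
    (hH : SatisfiesHeegnerHypothesis (W.conductorNorm ℤ) K)
    (hβ : (4 * (W.conductorNorm ℤ : ℤ)) ∣ β ^ 2 - NumberField.discr K) (hc : ¬ (p : ℤ) ∣ Dt.c)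
    (W₀ : WeierstrassCurve ℚ) [W₀.IsElliptic] [W₀.IsGloballyMinimal] [NeZero (W₀.conductorNorm ℤ)]
    (e : geomTorsion W (p : ℤ) ≃+ geomTorsion W₀ (p : ℤ))
    (he : ∀ (σ : absoluteGaloisGroup ℚ) (T : geomTorsion W (p : ℤ)), e (σ • T) = σ • e T)
    (hgood₀ : W₀.HasGoodReductionAtPrime p) (hna : ¬ (p : ℤ) ∣ W₀.frobeniusTrace p - 1)
    (hrad : ∀ q : ℕ, q.Prime → (q ∣ p * W.conductorNorm ℤ ↔ q ∣ p * W₀.conductorNorm ℤ))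
    (htype : ∀ (ℓ : ℕ) [Fact ℓ.Prime], W.HasMultiplicativeReductionAtPrime ℓ ↔ W₀.HasMultiplicativeReductionAtPrime ℓ)
    (hsign : ∀ (ℓ : ℕ) [Fact ℓ.Prime], W₀.HasMultiplicativeReductionAtPrime ℓ → W.LFunction ℓ = W₀.LFunction ℓ)
    (Dt₀ : ModularParametrizationData W₀ (W₀.conductorNorm ℤ)) (hc₀ : ¬ (p : ℤ) ∣ Dt₀.c)
    (hH₀ : SatisfiesHeegnerHypothesis (W₀.conductorNorm ℤ) K)
    (hsplit : ((Ideal.span {(p : ℤ)}).primesOver (𝓞 K)).ncard = 2) (ιp : K →+* ℚ_[p])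
    (hloss : ∃ (H₀ : HeegnerDatum (W₀.conductorNorm ℤ) (NumberField.discr K)) (y₀ : (W₀.baseChange K).toAffine.Point),
      WeierstrassCurve.Affine.Point.map ι.toRatAlgHom y₀ = heegnerPointComplex Dt₀ H₀ ∧
        ¬ ∃ Q : (W₀.baseChange ℚ_[p]).toAffine.Point, (p : ℤ) • Q = X11b.padicPointOf W₀ p ιp y₀) :
    ∃ (m : Finset {ℓ // Zhang2014.IsKolyvaginPrime (W.conductorNorm ℤ) W K p ℓ})
      (d : KolyvaginHeegnerData Dt β ι (∏ ℓ ∈ m, (ℓ : ℕ))), d.kolyvaginClass hp.out 1 ≠ 0 :=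
  exists_kolyvaginClass_ne_zero_of_thm116_of_lossless W p K Dt β ι hKL hp5 hadd hs hK hlt hH hβ hc W₀ e he hgood₀ hna
    (hdep_of_sign W W₀ p hrad htype hsign) Dt₀ hc₀ hH₀ hsplit ιp hloss

end Transfer

end Summit.BirchSwinnertonDyer.BirchSwinnertonDyer.Theorems.AdditiveKoly

end
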